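import Summits.CriticalPhenomena.PercolationContinuityZ3.Theorems.PercNearOneGluingNoHeavyLowerTailLevelPacking
import HarnessLib

/-!
# `NoHeavyLowerTail` (stmt-CriticalPhenomena-4575) — the level packing lemma in RATIO form (per-source bases)

Seat `prim-gen-swap` (gen 3), 2026-08-19.  Setting and notation of `…LevelPacking.lean` (gen 2): `μ = prodBernoulli w` on
`Fin n`, observer `o`, relays `A`, target block `T ⊆ A`, a partition `π` of `T` into source blocks, active sources
`π' ⊆ π` with increasing guards `Q_S` determined by the cluster of `A ∖ S`, `E_S = {o ↔ S}`, `D_S = {S ↮ A ∖ S}`,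
`Tgt = {T pairwise joined} ∩ {T ↮ A ∖ T}`.

* `levelPackingRatio` — `Theorems.levelPacking` with PER-SOURCE bounds `μ(D_S ∩ Q_S) ≤ t_S` (`0 ≤ t_S`; Lean's
  `x / 0 = 0`):  `(Σ_{S ∈ π'} μ(E_S ∩ D_S ∩ Q_S) / t_S) · μ(Tgt) ≤ μ(E_T ∩ Tgt)`, i.e. the ratio form
  `Σ_S P(o ↔ S | D_S ∩ Q_S) ≤ P(o ↔ T | Π has block T)` with the sources' OWN weights (the form in which the per-law
  LP certificates of the `|A| = 5` rung use the lemma, `ASSEMBLY-LP.md` / `CERT-STRUCTURE.md`; the common-bound form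
  of gen 2 loses the packing when the source weights differ).  Same mechanism: source step per block
  (`LevelPacking.sourceStep`), disjointness, target step (`LevelPacking.targetStep`); `μ(M) = 0` is removed by
  scaling the weights (`stub_weightContinuity`), restricting first to the sources with `t_S > 0`.
* consumer: `…LonelyObserver.lean` (Theorem A: singleton pockets are paid by the champion at every level).
-/

noncomputable section

namespace Summit.CriticalPhenomena.PercolationContinuityZ3.Theorems

open scoped BigOperators Classical Topology
open MeasureTheory Set Filter
open Literature.Probability.LatticeModels (prodBernoulli)
open Literature.Probability.Percolation
open BlockLonelyRelay GuardedBlockLonelyRelay AttachedChampionLevelOne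

variable {n : ℕ}

namespace LevelPacking

/-- **Level packing in ratio form when `μ(M) > 0`.** [this file] -/
theorem levelPackingRatio_of_pos (w : Sym2 (Fin n) → unitInterval) (A T : Finset (Fin n)) (hTA : T ⊆ A)
    (o : Fin n) (π π' : Finset (Finset (Fin n))) (hπ' : π' ⊆ π) (hsub : ∀ S ∈ π, S ⊆ T)
    (hcover : ∀ t ∈ T, ∃ S ∈ π, t ∈ S) (hdisj : ∀ S ∈ π, ∀ S' ∈ π, S ≠ S' → Disjoint S S')
    (Q : Finset (Fin n) → Set (BondConfig (Fin n)))
    (hQ : ∀ S ∈ π', ∃ G : Set (Sym2 (Fin n)) → ℝ, Monotone G ∧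
      ∀ ω, G (⋃ t ∈ (↑(A \ S) : Set (Fin n)), openEdgeCluster ω t) = (Q S).indicator 1 ω)
    (t : Finset (Fin n) → ℝ) (ht : ∀ S ∈ π', 0 ≤ t S)
    (hq : ∀ S ∈ π', (prodBernoulli w).real ({ω | ∀ b ∈ S, ∀ a ∈ A \ S, ω ∉ openConn b a} ∩ Q S) ≤ t S)
    (hM : 0 < (prodBernoulli w).real {ω | ∀ S ∈ π, ∀ b ∈ S, ∀ a ∈ A \ S, ω ∉ openConn b a}) :
    (∑ S ∈ π', (prodBernoulli w).real ({ω | ∃ b ∈ S, ω ∈ openConn o b} ∩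
        {ω | ∀ b ∈ S, ∀ a ∈ A \ S, ω ∉ openConn b a} ∩ Q S) / t S) *
      (prodBernoulli w).real ({ω | ∀ t ∈ T, ∀ t' ∈ T, ω ∈ openConn t t'} ∩
        {ω | ∀ t ∈ T, ∀ a ∈ A \ T, ω ∉ openConn t a}) ≤
    (prodBernoulli w).real ({ω | ∃ t ∈ T, ω ∈ openConn o t} ∩
      ({ω | ∀ t ∈ T, ∀ t' ∈ T, ω ∈ openConn t t'} ∩ {ω | ∀ t ∈ T, ∀ a ∈ A \ T, ω ∉ openConn t a})) := by
  set μ := prodBernoulli w with hμ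
  set M : Set (BondConfig (Fin n)) := {ω | ∀ S ∈ π, ∀ b ∈ S, ∀ a ∈ A \ S, ω ∉ openConn b a} with hMdef
  set Tgt : Set (BondConfig (Fin n)) := {ω | ∀ t ∈ T, ∀ t' ∈ T, ω ∈ openConn t t'} ∩
    {ω | ∀ t ∈ T, ∀ a ∈ A \ T, ω ∉ openConn t a} with hTgt
  set ET : Set (BondConfig (Fin n)) := {ω | ∃ t ∈ T, ω ∈ openConn o t} with hET
  have hsubA : ∀ S ∈ π, S ⊆ A := fun S hS => (hsub S hS).trans hTA
  -- source steps in ratio form, summed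
  have h1 : (∑ S ∈ π', μ.real ({ω | ∃ b ∈ S, ω ∈ openConn o b} ∩
      {ω | ∀ b ∈ S, ∀ a ∈ A \ S, ω ∉ openConn b a} ∩ Q S) / t S) * μ.real M ≤
      ∑ S ∈ π', μ.real ({ω | ∃ b ∈ S, ω ∈ openConn o b} ∩ M) := by
    rw [Finset.sum_mul]
    refine Finset.sum_le_sum fun S hS => ?_
    obtain ⟨G, hG, hGQ⟩ := hQ S hS
    have hstep := sourceStep w A o π hsubA hdisj (hπ' hS) (Q S) G hG hGQ (t S) (ht S hS) (hq S hS)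
    rcases (ht S hS).eq_or_lt with h0 | hpos
    · rw [← h0, div_zero, zero_mul]; exact measureReal_nonneg
    · rw [div_mul_eq_mul_div, div_le_iff₀ hpos, mul_comm _ (t S)]
      exact hstep
  -- disjointness: `Σ_{S ∈ π'} μ(E_S ∩ M) ≤ μ(E_T ∩ M)`
  have h2 : ∑ S ∈ π', μ.real ({ω | ∃ b ∈ S, ω ∈ openConn o b} ∩ M) ≤ μ.real (ET ∩ M) := by
    rw [← measureReal_biUnion_finset ((pairwiseDisjoint_join_inter π o hsubA hdisj).subset
      (Finset.coe_subset.2 hπ')) (fun S _ => MeasurableSet.of_discrete)]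
    refine measureReal_mono (Set.iUnion₂_subset fun S hS => ?_)
    rintro ω ⟨⟨b, hb, hob⟩, hωM⟩
    exact ⟨⟨b, hsub S (hπ' hS) hb, hob⟩, hωM⟩
  -- target step
  have h3 : μ.real (ET ∩ M) * μ.real Tgt ≤ μ.real M * μ.real (ET ∩ Tgt) := by
    have := targetStep w A T π hsub o
    rw [← M_eq A T π hTA hsub hcover hdisj] at this
    exact this
  have hT0 : 0 ≤ μ.real Tgt := measureReal_nonneg
  have h4 : (∑ S ∈ π', μ.real ({ω | ∃ b ∈ S, ω ∈ openConn o b} ∩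
      {ω | ∀ b ∈ S, ∀ a ∈ A \ S, ω ∉ openConn b a} ∩ Q S) / t S) * μ.real Tgt * μ.real M ≤
      μ.real (ET ∩ Tgt) * μ.real M := by
    calc (∑ S ∈ π', μ.real ({ω | ∃ b ∈ S, ω ∈ openConn o b} ∩
            {ω | ∀ b ∈ S, ∀ a ∈ A \ S, ω ∉ openConn b a} ∩ Q S) / t S) * μ.real Tgt * μ.real M
        = (∑ S ∈ π', μ.real ({ω | ∃ b ∈ S, ω ∈ openConn o b} ∩
            {ω | ∀ b ∈ S, ∀ a ∈ A \ S, ω ∉ openConn b a} ∩ Q S) / t S) * μ.real M * μ.real Tgt := by ring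
      _ ≤ (∑ S ∈ π', μ.real ({ω | ∃ b ∈ S, ω ∈ openConn o b} ∩ M)) * μ.real Tgt :=
          mul_le_mul_of_nonneg_right h1 hT0
      _ ≤ μ.real (ET ∩ M) * μ.real Tgt := mul_le_mul_of_nonneg_right h2 hT0
      _ ≤ μ.real M * μ.real (ET ∩ Tgt) := h3
      _ = μ.real (ET ∩ Tgt) * μ.real M := by ring
  exact le_of_mul_le_mul_right h4 hM

/-- **The level packing lemma in ratio form (unconditional).**  As `Theorems.levelPacking`, with per-source
bounds `μ({S ↮ A∖S} ∩ Q_S) ≤ t_S` (`0 ≤ t_S`; Lean's `x / 0 = 0`):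
`(Σ_{S ∈ π'} μ({o ↔ S} ∩ {S ↮ A∖S} ∩ Q_S) / t_S) · μ(Tgt) ≤ μ({o ↔ T} ∩ Tgt)`,
`Tgt = {T pairwise joined} ∩ {T ↮ A ∖ T}`.
[cite: KozmaNitzan2024, Lemmas 1–2 (pp. 5–6); VandenbergHaggstromKahn2005, Thms. 1.3, 1.5] -/
theorem levelPackingRatio (w : Sym2 (Fin n) → unitInterval) (A T : Finset (Fin n)) (hTA : T ⊆ A)
    (o : Fin n) (π π' : Finset (Finset (Fin n))) (hπ' : π' ⊆ π) (hsub : ∀ S ∈ π, S ⊆ T)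
    (hcover : ∀ t ∈ T, ∃ S ∈ π, t ∈ S) (hdisj : ∀ S ∈ π, ∀ S' ∈ π, S ≠ S' → Disjoint S S')
    (Q : Finset (Fin n) → Set (BondConfig (Fin n)))
    (hQ : ∀ S ∈ π', ∃ G : Set (Sym2 (Fin n)) → ℝ, Monotone G ∧
      ∀ ω, G (⋃ t ∈ (↑(A \ S) : Set (Fin n)), openEdgeCluster ω t) = (Q S).indicator 1 ω)
    (t : Finset (Fin n) → ℝ) (ht : ∀ S ∈ π', 0 ≤ t S)
    (hq : ∀ S ∈ π', (prodBernoulli w).real ({ω | ∀ b ∈ S, ∀ a ∈ A \ S, ω ∉ openConn b a} ∩ Q S) ≤ t S) :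
    (∑ S ∈ π', (prodBernoulli w).real ({ω | ∃ b ∈ S, ω ∈ openConn o b} ∩
        {ω | ∀ b ∈ S, ∀ a ∈ A \ S, ω ∉ openConn b a} ∩ Q S) / t S) *
      (prodBernoulli w).real ({ω | ∀ t ∈ T, ∀ t' ∈ T, ω ∈ openConn t t'} ∩
        {ω | ∀ t ∈ T, ∀ a ∈ A \ T, ω ∉ openConn t a}) ≤
    (prodBernoulli w).real ({ω | ∃ t ∈ T, ω ∈ openConn o t} ∩
      ({ω | ∀ t ∈ T, ∀ t' ∈ T, ω ∈ openConn t t'} ∩ {ω | ∀ t ∈ T, ∀ a ∈ A \ T, ω ∉ openConn t a})) := by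
  have hsubA : ∀ S ∈ π, S ⊆ A := fun S hS => (hsub S hS).trans hTA
  -- sources with `t_S = 0` contribute nothing: restrict to the positive ones
  set π'' := π'.filter fun S => 0 < t S with hπ''
  have hπ''sub : π'' ⊆ π' := Finset.filter_subset _ _
  have hsum_eq : ∀ (ν : Finset (Fin n) → ℝ),
      (∑ S ∈ π', ν S / t S) = ∑ S ∈ π'', ν S / t S := by
    intro ν
    rw [hπ'', Finset.sum_filter]
    refine Finset.sum_congr rfl fun S hS => ?_
    by_cases h : 0 < t S
    · rw [if_pos h]
    · have h0 : t S = 0 := le_antisymm (not_lt.1 h) (ht S hS)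
      rw [if_neg h, h0, div_zero]
  rw [hsum_eq]
  -- scaled weights `w_k = (1 - 1/(k+1)) • w`, all `< 1`, converging to `w`
  have hcmem : ∀ k : ℕ, ((1 : ℝ) - 1 / ((k : ℝ) + 1)) ∈ unitInterval := by
    intro k
    have hk : (0 : ℝ) < (k : ℝ) + 1 := Nat.cast_add_one_pos k
    have h1 : 1 / ((k : ℝ) + 1) ≤ 1 := by
      rw [div_le_one hk]; linarith [(Nat.cast_nonneg k : (0 : ℝ) ≤ k)]
    have h0 : 0 ≤ 1 / ((k : ℝ) + 1) := by positivity
    exact ⟨by linarith, by linarith⟩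
  set wk : ℕ → Sym2 (Fin n) → unitInterval :=
    fun k e => ⟨(1 - 1 / ((k : ℝ) + 1)) * (w e : ℝ), unitInterval.mul_mem (hcmem k) (w e).2⟩
    with hwk_def
  have hwk_lt : ∀ k e, ((wk k e : unitInterval) : ℝ) < 1 := by
    intro k e
    have hk : (0 : ℝ) < (k : ℝ) + 1 := Nat.cast_add_one_pos k
    have hc : (1 : ℝ) - 1 / ((k : ℝ) + 1) < 1 := by
      have : 0 < 1 / ((k : ℝ) + 1) := by positivity
      linarith
    calc ((wk k e : unitInterval) : ℝ) = (1 - 1 / ((k : ℝ) + 1)) * (w e : ℝ) := rfl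
      _ ≤ (1 - 1 / ((k : ℝ) + 1)) := mul_le_of_le_one_right (hcmem k).1 (w e).2.2
      _ < 1 := hc
  have hc_lim : Tendsto (fun k : ℕ => (1 : ℝ) - 1 / ((k : ℝ) + 1)) atTop (𝓝 1) := by
    simpa using tendsto_const_nhds.sub (tendsto_one_div_add_atTop_nhds_zero_nat (𝕜 := ℝ))
  have hwk_lim : Tendsto wk atTop (𝓝 w) := by
    refine tendsto_pi_nhds.2 fun e => ?_
    rw [tendsto_subtype_rng]
    have h := hc_lim.mul_const (w e : ℝ)
    rw [one_mul] at h
    exact h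
  have hlimE : ∀ E : Set (Set (Sym2 (Fin n))),
      Tendsto (fun k => (prodBernoulli (wk k)).real E) atTop (𝓝 ((prodBernoulli w).real E)) :=
    fun E => ((stub_weightContinuity n E).tendsto w).comp hwk_lim
  set δ : ℕ → ℝ := fun k => ∑ S ∈ π'',
      |(prodBernoulli (wk k)).real ({ω | ∀ b ∈ S, ∀ a ∈ A \ S, ω ∉ openConn b a} ∩ Q S) -
        (prodBernoulli w).real ({ω | ∀ b ∈ S, ∀ a ∈ A \ S, ω ∉ openConn b a} ∩ Q S)| with hδ_def
  have hδ0 : ∀ k, 0 ≤ δ k := fun k => Finset.sum_nonneg fun S _ => abs_nonneg _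
  have hδ_lim : Tendsto δ atTop (𝓝 0) := by
    have h : ∀ S ∈ π'', Tendsto (fun k =>
        |(prodBernoulli (wk k)).real ({ω | ∀ b ∈ S, ∀ a ∈ A \ S, ω ∉ openConn b a} ∩ Q S) -
          (prodBernoulli w).real ({ω | ∀ b ∈ S, ∀ a ∈ A \ S, ω ∉ openConn b a} ∩ Q S)|) atTop (𝓝 0) := by
      intro S _
      simpa using (tendsto_sub_nhds_zero_iff.2
        (hlimE ({ω | ∀ b ∈ S, ∀ a ∈ A \ S, ω ∉ openConn b a} ∩ Q S))).abs
    simpa [hδ_def] using tendsto_finsetSum π'' h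
  have hk : ∀ k, (∑ S ∈ π'', (prodBernoulli (wk k)).real ({ω | ∃ b ∈ S, ω ∈ openConn o b} ∩
      {ω | ∀ b ∈ S, ∀ a ∈ A \ S, ω ∉ openConn b a} ∩ Q S) / (t S + δ k)) *
      (prodBernoulli (wk k)).real ({ω | ∀ t ∈ T, ∀ t' ∈ T, ω ∈ openConn t t'} ∩
        {ω | ∀ t ∈ T, ∀ a ∈ A \ T, ω ∉ openConn t a}) ≤
      (prodBernoulli (wk k)).real ({ω | ∃ t ∈ T, ω ∈ openConn o t} ∩
        ({ω | ∀ t ∈ T, ∀ t' ∈ T, ω ∈ openConn t t'} ∩ {ω | ∀ t ∈ T, ∀ a ∈ A \ T, ω ∉ openConn t a})) := by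
    intro k
    refine levelPackingRatio_of_pos (wk k) A T hTA o π π'' (hπ''sub.trans hπ') hsub hcover hdisj Q
      (fun S hS => hQ S (hπ''sub hS)) (fun S => t S + δ k) (fun S hS => by linarith [hδ0 k, ht S (hπ''sub hS)])
      ?_ ?_
    · intro S hS
      have h1 := hq S (hπ''sub hS)
      have h2 : |(prodBernoulli (wk k)).real ({ω | ∀ b ∈ S, ∀ a ∈ A \ S, ω ∉ openConn b a} ∩ Q S) -
            (prodBernoulli w).real ({ω | ∀ b ∈ S, ∀ a ∈ A \ S, ω ∉ openConn b a} ∩ Q S)| ≤ δ k :=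
        Finset.single_le_sum (f := fun S =>
          |(prodBernoulli (wk k)).real ({ω | ∀ b ∈ S, ∀ a ∈ A \ S, ω ∉ openConn b a} ∩ Q S) -
            (prodBernoulli w).real ({ω | ∀ b ∈ S, ∀ a ∈ A \ S, ω ∉ openConn b a} ∩ Q S)|)
          (fun S _ => abs_nonneg _) hS
      have h3 := le_abs_self
        ((prodBernoulli (wk k)).real ({ω | ∀ b ∈ S, ∀ a ∈ A \ S, ω ∉ openConn b a} ∩ Q S) -
          (prodBernoulli w).real ({ω | ∀ b ∈ S, ∀ a ∈ A \ S, ω ∉ openConn b a} ∩ Q S))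
      linarith
    · exact lt_of_lt_of_le (singleFinger_pairSep_real_pos (wk k) (hwk_lt k) A)
        (measureReal_mono (sepAll_subset_M A π hsubA hdisj))
  have hlimL : Tendsto (fun k => (∑ S ∈ π'', (prodBernoulli (wk k)).real ({ω | ∃ b ∈ S, ω ∈ openConn o b} ∩
      {ω | ∀ b ∈ S, ∀ a ∈ A \ S, ω ∉ openConn b a} ∩ Q S) / (t S + δ k)) *
      (prodBernoulli (wk k)).real ({ω | ∀ t ∈ T, ∀ t' ∈ T, ω ∈ openConn t t'} ∩
        {ω | ∀ t ∈ T, ∀ a ∈ A \ T, ω ∉ openConn t a})) atTop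
      (𝓝 ((∑ S ∈ π'', (prodBernoulli w).real ({ω | ∃ b ∈ S, ω ∈ openConn o b} ∩
        {ω | ∀ b ∈ S, ∀ a ∈ A \ S, ω ∉ openConn b a} ∩ Q S) / t S) *
        (prodBernoulli w).real ({ω | ∀ t ∈ T, ∀ t' ∈ T, ω ∈ openConn t t'} ∩
          {ω | ∀ t ∈ T, ∀ a ∈ A \ T, ω ∉ openConn t a}))) := by
    refine (tendsto_finsetSum π'' fun S hS => ?_).mul (hlimE _)
    have htS : 0 < t S := (Finset.mem_filter.1 hS).2
    have hden : Tendsto (fun k => t S + δ k) atTop (𝓝 (t S)) := by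
      simpa using tendsto_const_nhds.add hδ_lim
    exact (hlimE _).div hden htS.ne'
  exact le_of_tendsto_of_tendsto' hlimL (hlimE _) hk

end LevelPacking

end Summit.CriticalPhenomena.PercolationContinuityZ3.Theorems

end
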